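import Literature.AlgebraicGeometry.Motives.AbelianVarietyHondaTate
import Literature.AlgebraicGeometry.FiniteFields.WeilNumberTraceForm
import HarnessLib

/-!
# The trace form of the Frobenius of an abelian variety over a finite field is positive definite
# (from Weil's Riemann hypothesis), and conversely

Topic `Literature/AlgebraicGeometry/Motives`; grouping namespace `AbelianVariety`. All proved; no
definitions; no named facts (the two theorems are CONDITIONAL on the tree's named fact
`AbelianVariety.weilRiemannHypothesis` exactly where Weil's theorem is used).

J. S. Milne, *Abelian Varieties* (in Cornell–Silverman, *Arithmetic Geometry*, 1986)
[Milne1986AbelianVarieties], §17 Thm. 17.3 (p. 137: "The bilinear form `(α, β) ↦ Tr(α ∘ β†)` … is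
positive definite") and §19, Lemma 19.2 (p. 145: `π_A† ∘ π_A = q_A`), Lemma 19.3 and Thm. 19.1 (c)
(the Riemann hypothesis `|a_i| = q^{1/2}` for the roots `a_i` of the characteristic polynomial `P_A`
of the Frobenius `π_A`). Restricted to the commutative subalgebra `ℚ[π_A] ⊂ End⁰(A)` and written in
root coordinates (`Literature.AlgebraicGeometry.FiniteFields.WeilTraceForm.traceGram`: the Gram matrix
`(Σ_k a_kⁱ (q/a_k)ʲ)_{ij} = (q^{min(i,j)} s_{|i-j|})_{ij}` of `(x, y) ↦ Tr(x · y†)`, `π† = q/π`, in the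
power basis `1, π, …, π^{2g-1}`), Milne's two statements read:

* `AbelianVariety.posDef_traceGram_of_weilRiemannHypothesis`: **Weil ⟹ positivity.** If `P` is the
  characteristic polynomial of the Frobenius of `A/𝔽_q` and `a : Fin n → ℂ` is an injective family
  of roots of `P` (e.g. all of them when `P` is squarefree), then — granted Weil's Riemann hypothesis
  for `A` (the named fact `weilRiemannHypothesis A`) — the trace Gram matrix of `a` at `q = #𝔽_q` is
  positive definite.
* `AbelianVariety.norm_eq_sqrt_of_posDef_traceGram`: **positivity ⟹ Weil**, unconditionally: if the
  distinct roots `a_k` are stable under `a ↦ q/a` (the functional equation of `P_A`) and under complex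
  conjugation (`P_A ∈ ℤ[X]`) and their trace Gram matrix is positive definite, then `‖a_k‖ = √q` for
  every `k` — Milne's Lemma 19.3 for `α = π_A`, `r = q`.

So at finite level, for `P_A` squarefree, "the trace form of `ℤ[π_A]` is positive definite" and "the
Riemann hypothesis holds for `P_A`" are the same statement; the first is decidable in exact arithmetic
from the coefficients of `P_A`.

Deliberately NOT here: the enumeration of the roots of `P_A` as a family `Fin (2 dim A) → ℂ` and the
derivation of the functional-equation / conjugation stability from `P_A ∈ ℤ[X]` and
`P_A(X) = q^{-g} X^{2g} P_A(q/X)` (hypotheses are taken in root form, as in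
`WeilNumberTraceForm.lean`); the Rosati involution itself (the tree has no polarisations on
`AbelianVariety K`).
-/

noncomputable section

open Polynomial
open scoped ComplexOrder ComplexConjugate

universe u

namespace Literature.AlgebraicGeometry.Motives

namespace AbelianVariety

open Literature.AlgebraicGeometry.FiniteFields

variable {K : Type u} [Field K] [Finite K]

/-- **Weil's Riemann hypothesis ⟹ the trace form of `ℤ[π_A]` is positive definite** (Milne: "the
existence and positivity of the Rosati involution can be used to prove the Riemann hypothesis"; here
the implication is read backwards at finite level). For `P` the characteristic polynomial of the
Frobenius of `A/𝔽_q`, `q = #𝔽_q`, and any injective family `a` of complex roots of `P`, the matrix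
`(Σ_k a_kⁱ (q/a_k)ʲ)_{ij}` is positive definite — conditional on the named fact
`weilRiemannHypothesis A`. [cite: Milne1986AbelianVarieties, §17 Thm. 17.3 (p. 137) and §19 Thm. 19.1 (c), Lemma 19.2 (p. 145)] -/
theorem posDef_traceGram_of_weilRiemannHypothesis (A : AbelianVariety K)
    (hW : A.weilRiemannHypothesis) {P : ℤ[X]} (hP : A.IsFrobCharpoly P) {n : ℕ} {a : Fin n → ℂ}
    (hinj : Function.Injective a) (hroots : ∀ k, a k ∈ (P.map (Int.castRingHom ℂ)).roots) :
    (WeilTraceForm.traceGram (Nat.card K : ℂ) a).PosDef := by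
  haveI : Fintype K := Fintype.ofFinite K
  have hq : (0 : ℝ) < (Nat.card K : ℝ) := by
    have : 0 < Nat.card K := Nat.card_pos
    exact_mod_cast this
  have h := WeilTraceForm.posDef_traceGram_of_norm_eq_sqrt hq hinj (fun k => hW P hP (a k) (hroots k))
  simpa only [Complex.ofReal_natCast] using h

/-- **The trace form of `ℤ[π_A]` positive definite ⟹ the Riemann hypothesis for `P_A`** (Milne,
Lemma 19.3 with `α = π_A`, `α† α = q`), unconditionally: for pairwise distinct complex numbers `a_k`
stable under `a ↦ q/a` (`WeilTraceForm.IsFEPerm`, the functional equation) and under complex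
conjugation, `q = #𝔽_q`, positive definiteness of `(Σ_k a_kⁱ (q/a_k)ʲ)_{ij}` forces `‖a_k‖ = √q` for
all `k`. (No abelian variety enters the statement; it is recorded here, next to
`weilRiemannHypothesis`, as the finite-level form of Lemma 19.3.)
[cite: Milne1986AbelianVarieties, §19 Lemma 19.3, pp. 145–146] -/
theorem norm_eq_sqrt_of_posDef_traceGram (K : Type u) [Field K] [Finite K] {n : ℕ} {a : Fin n → ℂ}
    {σ : Equiv.Perm (Fin n)} (hσ : WeilTraceForm.IsFEPerm (Nat.card K : ℂ) a σ)
    (hinj : Function.Injective a) (hconj : ∀ k, ∃ l, a l = conj (a k))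
    (hG : (WeilTraceForm.traceGram (Nat.card K : ℂ) a).PosDef) (k : Fin n) :
    ‖a k‖ = Real.sqrt (Nat.card K) := by
  haveI : Fintype K := Fintype.ofFinite K
  have hq : (0 : ℝ) < (Nat.card K : ℝ) := by
    have : 0 < Nat.card K := Nat.card_pos
    exact_mod_cast this
  have hσ' : WeilTraceForm.IsFEPerm ((Nat.card K : ℝ) : ℂ) a σ := by
    simpa only [Complex.ofReal_natCast] using hσ
  have hG' : (WeilTraceForm.traceGram ((Nat.card K : ℝ) : ℂ) a).PosDef := by
    simpa only [Complex.ofReal_natCast] using hG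
  exact ((hσ'.posDef_traceGram_iff_norm_eq_sqrt hq hinj hconj).1 hG') k

end AbelianVariety

end Literature.AlgebraicGeometry.Motives
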